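import Summits.CriticalPhenomena.PercolationContinuityZ3.Theorems.PercNearOneGluingNoHeavyConstsCrossReachSharpGadget
import HarnessLib

/-!
# The hypothesis `μ(S ↮ T) ≤ μ(S ↔ T)` of the measure-level cross-reach row is SHARP: a four-vertex family with
# `X < 0` for every connection probability `μ(S ↔ T) < ½` (PAPER-2 track (ii); lane `prim-facecert`, gen 17)

builds on p205010 (kernel theorem, internal audit signed; external expert review pending).  Support file (`--supports
stmt-CriticalPhenomena-4575`); second of two files (the gadget's connectivity and cell masses are in
`…ConstsCrossReachSharpGadget.lean`, namespace `Consts.CrossReachSharp`).  Answers the question left open by `Consts.crossReach_measure_of_disconnect_le`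
(`…ConstsCrossReachMeasureHalf.lean`, p338025: the cross-reach row `X(T) ≥ 0` at measure level whenever `μ(S ↮ T) ≤ μ(S ↔ T)`)
and by its refutation without the hypothesis `Consts.not_crossReach_measure` (`…ConstsCrossReachMeasureRefutation.lean`, p342143,
an eight-vertex witness with `μ(S ↔ T) = 4.4·10⁻⁴`; violations were known only up to `μ(S ↔ T) ≈ 0.09`, lane memo FINDING-gen16 §3,
and `prim-nh-lead-4575` LEAD-GEN109 NEXT SEAT (4) lists "is `μ(S↮v) ≤ μ(S↔v)` sharp" as open):
**the threshold `½` is exact.**  Theorems only; no sorries; standard axioms; no `decide`.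

THE ROW.  `μ = prodBernoulli w`, `U = {S ↔ T}`, `D = {S ↮ T}`, `A = {P(C_S)}`, `B = {Q(C_S)}` for monotone `P, Q` of the OPEN EDGE
CLUSTER `C_S = ⋃_{s ∈ S} openEdgeCluster ω s` (van den Berg–Häggström–Kahn's `C_s` is a set of EDGES, and so is the cluster argument
of the lead's rows and of p338025/p342143); `X/2 = μ(ABU)μ(D) + μ(ABD)μ(U) − μ(AU)μ(BD) − μ(BU)μ(AD)
= μ(U)μ(D)·[Cov(A,B | U) + Cov(A,B | D) + (μ(A|U) − μ(A|D))(μ(B|U) − μ(B|D))]`.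

THE MECHANISM (new; not a pendant on a containment witness): a SERIES–PARALLEL gate `U = W ∩ (F ∪ G)`.  On four distinct vertices
`s, x, m, v` of any finite vertex type let the only pairs of positive weight be `sx (p₁), xm (p₂), sm (q), mv (t)` ("a path
`s – x – m` with the chord `s – m` and a pendant `m – v`"), `S = {s}`, `T = {v}`, and take the one-edge cluster events
`A = [sx ∈ C_S]` (`= {sx open}`) and `B = [sm ∈ C_S]` (`= {sm open}`).  Almost surely `s ↔ v` iff `mv` is open AND (`sm` is open OR
both `sx, xm` are open) (`CrossReachSharp.reachable_iff`, `reach_ae_eq`), the three ingredients being independent; so given `D`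
the pair `(A, B)` is a MIXTURE of the unconditioned law (`mv` closed) and the law given "both routes to `m` failed" — positively
correlated, as BHK demands — while given `U` the two routes explain each other away.  Exactly (`CrossReachSharp.masses`,
`CrossReachSharp.cells`):
  `μ(U) = t·(q + p₁p₂ − q·p₁p₂)`,   `X/2 = −p₁(1−p₁)·p₂·q(1−q)·t·(1 − 2t)`,
negative precisely when `t < ½`; letting `t ↑ ½`, `p₁p₂, q ↑ 1` the connection probability `μ(U) = t·(1 − (1−p₁p₂)(1−q))` fills
`(0, ½)`.  (With the two-edge route event `A = [sx, xm ∈ C_S]` instead: `X/2 = −t(1−2t)·φ(1−φ)·q(1−q)`, `φ = p₁p₂`; the strata of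
LEAD-GEN106 §2 on this family are `(K₀, K₁, K₂) = 2φ(1−φ)q(1−q)·(t(1−t), −t(1−2t), −t²)` with Harris slack `0`, which also shows
that a valid measure-level combination `αK₀ + βK₁ + γK₂ ≥ 0` must have `α ≥ β ≥ γ` — lane memo FINDING-gen17.)
* `Consts.crossReach_theta_lt` — on this family the cross-reach row FAILS (`RHS < LHS`) whenever `0 < p₁ < 1`, `0 < p₂`, `0 < q < 1`,
  `0 < t < ½` (any finite vertex type, any four distinct vertices).
* `Consts.crossReach_measure_sharp` — **for every real `r < ½` there are `n`, weights `w` on `Sym2 (Fin n)`, sets `S, T` and monotone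
  `P, Q` with `μ(S ↔ T) > r` and `μ(A∩U)μ(B∩D) + μ(B∩U)μ(A∩D) > μ(A∩B∩U)μ(D) + μ(A∩B∩D)μ(U)`** (`n = 4`).  With p338025 this pins the
  measure-level cross-reach row down completely: a law of percolation exactly in the regime `μ(S ↔ T) ≥ ½`.
* `Consts.oneCopyContain_theta_lt` — on the same family the CONTAINMENT row `IN = μ(ABU) + μ(U)μ(AB) − μ(AU)μ(B) − μ(BU)μ(A)`
  equals `−p₁(1−p₁)p₂q(1−q)·t < 0` for EVERY `t ∈ (0, 1]`: a four-vertex refutation of the containment row (the kernel witness of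
  `Consts.not_oneCopyContain_measure`, p341658, has seven vertices and vertex events; for VERTEX events `[x ∈ V(C_S)]` seven vertices
  are necessary by the lane's censuses, and for them the largest connection probability with `X < 0` remains open in `[0.09, ½)` —
  back-flow through the hub `m` destroys the mechanism above).
[cite: VandenbergHaggstromKahn2005, Thm. 1.3 (p. 6) with Remark 1 after Thm. 1.2 (p. 5); §1 p. 3 (definition of C_s)]
[cite: Grimmett1999, §1.3 p. 10; §2.2]
-/

noncomputable section

namespace Summit.CriticalPhenomena.PercolationContinuityZ3.Theorems

namespace Consts

open MeasureTheory Set Literature.Probability.LatticeModels Literature.Probability.Percolation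
open scoped Classical

variable {V : Type*} [Fintype V]


/-- **The cross-reach row FAILS on the series–parallel gadget whenever `w(mv) < ½`.**  On any finite vertex type, for four distinct
vertices `s, x, m, v` carrying all the positive weight on the pairs `sx (p₁), xm (p₂), sm (q), mv (t)`, with `S = {s}`, `T = {v}` and
the one-edge cluster events `A = [s(s,x) ∈ C_S]`, `B = [s(s,m) ∈ C_S]`:
`μ(A∩B∩U)·μ(D) + μ(A∩B∩D)·μ(U) < μ(A∩U)·μ(B∩D) + μ(B∩U)·μ(A∩D)` as soon as `0 < p₁ < 1`, `0 < p₂`, `0 < q < 1`, `0 < t < ½`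
(the difference is `p₁(1−p₁)·p₂·q(1−q)·t(1−2t)`).  (this lane, gen 17)
[cite: VandenbergHaggstromKahn2005, Thm. 1.3 (p. 6) with Remark 1 after Thm. 1.2 (p. 5)] -/
theorem crossReach_theta_lt [DecidableEq V] (w : Sym2 V → unitInterval) {s x m v : V} (hsx : s ≠ x) (hsm : s ≠ m) (hsv : s ≠ v)
    (hxm : x ≠ m) (hxv : x ≠ v) (hmv : m ≠ v) (hw0 : ∀ e, e ∉ ({s(s, x), s(x, m), s(s, m), s(m, v)} : Finset (Sym2 V)) → w e = 0)
    (hp₁ : 0 < (w s(s, x) : ℝ)) (hp₁' : (w s(s, x) : ℝ) < 1) (hp₂ : 0 < (w s(x, m) : ℝ)) (hq : 0 < (w s(s, m) : ℝ))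
    (hq' : (w s(s, m) : ℝ) < 1) (ht : 0 < (w s(m, v) : ℝ)) (ht' : (w s(m, v) : ℝ) < 1 / 2) :
    (prodBernoulli w).real ({ω : BondConfig V | s(s, x) ∈ ⋃ s' ∈ ({s} : Set V), openEdgeCluster ω s'} ∩
          {ω | s(s, m) ∈ ⋃ s' ∈ ({s} : Set V), openEdgeCluster ω s'} ∩
          {ω | ∃ s' ∈ ({s} : Set V), ∃ t ∈ ({v} : Set V), (openGraph ω).Reachable s' t}) *
        (prodBernoulli w).real {ω : BondConfig V | ∀ s' ∈ ({s} : Set V), ∀ t ∈ ({v} : Set V),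
          ¬ (openGraph ω).Reachable s' t} +
      (prodBernoulli w).real ({ω : BondConfig V | s(s, x) ∈ ⋃ s' ∈ ({s} : Set V), openEdgeCluster ω s'} ∩
          {ω | s(s, m) ∈ ⋃ s' ∈ ({s} : Set V), openEdgeCluster ω s'} ∩
          {ω | ∀ s' ∈ ({s} : Set V), ∀ t ∈ ({v} : Set V), ¬ (openGraph ω).Reachable s' t}) *
        (prodBernoulli w).real {ω : BondConfig V | ∃ s' ∈ ({s} : Set V), ∃ t ∈ ({v} : Set V),
          (openGraph ω).Reachable s' t} <
    (prodBernoulli w).real ({ω : BondConfig V | s(s, x) ∈ ⋃ s' ∈ ({s} : Set V), openEdgeCluster ω s'} ∩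
          {ω | ∃ s' ∈ ({s} : Set V), ∃ t ∈ ({v} : Set V), (openGraph ω).Reachable s' t}) *
        (prodBernoulli w).real ({ω : BondConfig V | s(s, m) ∈ ⋃ s' ∈ ({s} : Set V), openEdgeCluster ω s'} ∩
          {ω | ∀ s' ∈ ({s} : Set V), ∀ t ∈ ({v} : Set V), ¬ (openGraph ω).Reachable s' t}) +
      (prodBernoulli w).real ({ω : BondConfig V | s(s, m) ∈ ⋃ s' ∈ ({s} : Set V), openEdgeCluster ω s'} ∩
          {ω | ∃ s' ∈ ({s} : Set V), ∃ t ∈ ({v} : Set V), (openGraph ω).Reachable s' t}) *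
        (prodBernoulli w).real ({ω : BondConfig V | s(s, x) ∈ ⋃ s' ∈ ({s} : Set V), openEdgeCluster ω s'} ∩
          {ω | ∀ s' ∈ ({s} : Set V), ∀ t ∈ ({v} : Set V), ¬ (openGraph ω).Reachable s' t}) := by
  rw [CrossReachSharp.edgeEvent_eq hsx, CrossReachSharp.edgeEvent_eq hsm, CrossReachSharp.reachEvent_eq,
    CrossReachSharp.notReachEvent_eq]
  obtain ⟨cU, cD, cAU, cAD, cBU, cBD, cABU, cABD⟩ := CrossReachSharp.cells w hsx hsm hsv hxm hxv hmv hw0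
  rw [cU, cD, cAU, cAD, cBU, cBD, cABU, cABD]
  set p₁ : ℝ := ((w s(s, x) : unitInterval) : ℝ)
  set p₂ : ℝ := ((w s(x, m) : unitInterval) : ℝ)
  set q : ℝ := ((w s(s, m) : unitInterval) : ℝ)
  set t : ℝ := ((w s(m, v) : unitInterval) : ℝ)
  have h1 : 0 < 1 - p₁ := by linarith
  have h2 : 0 < 1 - q := by linarith
  have h3 : 0 < 1 - 2 * t := by linarith
  have pos : 0 < p₁ * (1 - p₁) * p₂ * q * (1 - q) * t * (1 - 2 * t) := by positivity
  nlinarith [pos]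

/-- **The containment row FAILS on the series–parallel gadget for EVERY `w(mv) > 0`** (same data as `crossReach_theta_lt`, no
condition on `t` beyond `t > 0`): `μ(A∩U)μ(B) + μ(B∩U)μ(A) > μ(A∩B∩U) + μ(U)μ(A∩B)`, the difference being `p₁(1−p₁)·p₂·q(1−q)·t` —
a four-vertex refutation of the measure-level containment row IN (the kernel witness of `Consts.not_oneCopyContain_measure` has seven
vertices and vertex events).  (this lane, gen 17) [cite: VandenbergHaggstromKahn2005, Thm. 1.3 (p. 6)] -/
theorem oneCopyContain_theta_lt [DecidableEq V] (w : Sym2 V → unitInterval) {s x m v : V} (hsx : s ≠ x) (hsm : s ≠ m) (hsv : s ≠ v)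
    (hxm : x ≠ m) (hxv : x ≠ v) (hmv : m ≠ v) (hw0 : ∀ e, e ∉ ({s(s, x), s(x, m), s(s, m), s(m, v)} : Finset (Sym2 V)) → w e = 0)
    (hp₁ : 0 < (w s(s, x) : ℝ)) (hp₁' : (w s(s, x) : ℝ) < 1) (hp₂ : 0 < (w s(x, m) : ℝ)) (hq : 0 < (w s(s, m) : ℝ))
    (hq' : (w s(s, m) : ℝ) < 1) (ht : 0 < (w s(m, v) : ℝ)) :
    (prodBernoulli w).real ({ω : BondConfig V | s(s, x) ∈ ⋃ s' ∈ ({s} : Set V), openEdgeCluster ω s'} ∩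
          {ω | s(s, m) ∈ ⋃ s' ∈ ({s} : Set V), openEdgeCluster ω s'} ∩
          {ω | ∃ s' ∈ ({s} : Set V), ∃ t ∈ ({v} : Set V), (openGraph ω).Reachable s' t}) +
      (prodBernoulli w).real {ω : BondConfig V | ∃ s' ∈ ({s} : Set V), ∃ t ∈ ({v} : Set V),
          (openGraph ω).Reachable s' t} *
        (prodBernoulli w).real ({ω : BondConfig V | s(s, x) ∈ ⋃ s' ∈ ({s} : Set V), openEdgeCluster ω s'} ∩
          {ω | s(s, m) ∈ ⋃ s' ∈ ({s} : Set V), openEdgeCluster ω s'}) <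
    (prodBernoulli w).real ({ω : BondConfig V | s(s, x) ∈ ⋃ s' ∈ ({s} : Set V), openEdgeCluster ω s'} ∩
          {ω | ∃ s' ∈ ({s} : Set V), ∃ t ∈ ({v} : Set V), (openGraph ω).Reachable s' t}) *
        (prodBernoulli w).real {ω : BondConfig V | s(s, m) ∈ ⋃ s' ∈ ({s} : Set V), openEdgeCluster ω s'} +
      (prodBernoulli w).real ({ω : BondConfig V | s(s, m) ∈ ⋃ s' ∈ ({s} : Set V), openEdgeCluster ω s'} ∩
          {ω | ∃ s' ∈ ({s} : Set V), ∃ t ∈ ({v} : Set V), (openGraph ω).Reachable s' t}) *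
        (prodBernoulli w).real {ω : BondConfig V | s(s, x) ∈ ⋃ s' ∈ ({s} : Set V), openEdgeCluster ω s'} := by
  rw [CrossReachSharp.edgeEvent_eq hsx, CrossReachSharp.edgeEvent_eq hsm, CrossReachSharp.reachEvent_eq]
  obtain ⟨mU, mAU, mBU, mABU, mA, mB, mAB⟩ := CrossReachSharp.masses w hsx hsm hsv hxm hxv hmv hw0
  rw [mU, mAU, mBU, mABU, mA, mB, mAB]
  set p₁ : ℝ := ((w s(s, x) : unitInterval) : ℝ)
  set p₂ : ℝ := ((w s(x, m) : unitInterval) : ℝ)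
  set q : ℝ := ((w s(s, m) : unitInterval) : ℝ)
  set t : ℝ := ((w s(m, v) : unitInterval) : ℝ)
  have h1 : 0 < 1 - p₁ := by linarith
  have h2 : 0 < 1 - q := by linarith
  have pos : 0 < p₁ * (1 - p₁) * p₂ * q * (1 - q) * t := by positivity
  nlinarith [pos]

/-! ### Sharpness of `μ(S ↮ T) ≤ μ(S ↔ T)`: instances on `Fin 4` with `μ(S ↔ T) ↑ ½` -/

/-- **SHARPNESS of the hypothesis `μ(S ↮ T) ≤ μ(S ↔ T)` in `Consts.crossReach_measure_of_disconnect_le`.**  For every real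
`r < ½` there are a finite weighted graph (`n = 4` vertices), sets `S, T` and increasing edge-cluster events `A = {P(C_S)}`,
`B = {Q(C_S)}` with connection probability `μ(S ↔ T) > r` for which the measure-level cross-reach row FAILS:
`μ(A∩B∩U)·μ(D) + μ(A∩B∩D)·μ(U) < μ(A∩U)·μ(B∩D) + μ(B∩U)·μ(A∩D)`.  Together with p338025 (the row holds whenever `μ(S ↔ T) ≥ ½`) the
threshold `½` is exact.  Instance: the series–parallel gadget `01 (a), 12 (1), 02 (a), 23 (b)` with `S = {0}`, `T = {3}`, `A = [01 ∈ C_S]`,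
`B = [02 ∈ C_S]`, `b = (1 + 4r⁺)/6 < ½`, `a = (2 + 2r⁺)/3`, where `μ(S ↔ T) = b(2a − a²) > r⁺ = max r 0`.  (this lane, gen 17)
[cite: VandenbergHaggstromKahn2005, Thm. 1.3 (p. 6) with Remark 1 after Thm. 1.2 (p. 5)] -/
theorem crossReach_measure_sharp (r : ℝ) (hr : r < 1 / 2) :
    ∃ (n : ℕ) (w : Sym2 (Fin n) → unitInterval) (S T : Set (Fin n)) (P Q : Set (Sym2 (Fin n)) → Prop),
      (∀ ⦃C C' : Set (Sym2 (Fin n))⦄, C ⊆ C' → P C → P C') ∧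
      (∀ ⦃C C' : Set (Sym2 (Fin n))⦄, C ⊆ C' → Q C → Q C') ∧
      r < (prodBernoulli w).real {ω : BondConfig (Fin n) | ∃ s ∈ S, ∃ t ∈ T, (openGraph ω).Reachable s t} ∧
      (prodBernoulli w).real ({ω : BondConfig (Fin n) | P (⋃ s ∈ S, openEdgeCluster ω s)} ∩
            {ω | Q (⋃ s ∈ S, openEdgeCluster ω s)} ∩ {ω | ∃ s ∈ S, ∃ t ∈ T, (openGraph ω).Reachable s t}) *
          (prodBernoulli w).real {ω : BondConfig (Fin n) | ∀ s ∈ S, ∀ t ∈ T, ¬ (openGraph ω).Reachable s t} +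
        (prodBernoulli w).real ({ω : BondConfig (Fin n) | P (⋃ s ∈ S, openEdgeCluster ω s)} ∩
            {ω | Q (⋃ s ∈ S, openEdgeCluster ω s)} ∩ {ω | ∀ s ∈ S, ∀ t ∈ T, ¬ (openGraph ω).Reachable s t}) *
          (prodBernoulli w).real {ω : BondConfig (Fin n) | ∃ s ∈ S, ∃ t ∈ T, (openGraph ω).Reachable s t} <
      (prodBernoulli w).real ({ω : BondConfig (Fin n) | P (⋃ s ∈ S, openEdgeCluster ω s)} ∩
            {ω | ∃ s ∈ S, ∃ t ∈ T, (openGraph ω).Reachable s t}) *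
          (prodBernoulli w).real ({ω : BondConfig (Fin n) | Q (⋃ s ∈ S, openEdgeCluster ω s)} ∩
            {ω | ∀ s ∈ S, ∀ t ∈ T, ¬ (openGraph ω).Reachable s t}) +
        (prodBernoulli w).real ({ω : BondConfig (Fin n) | Q (⋃ s ∈ S, openEdgeCluster ω s)} ∩
            {ω | ∃ s ∈ S, ∃ t ∈ T, (openGraph ω).Reachable s t}) *
          (prodBernoulli w).real ({ω : BondConfig (Fin n) | P (⋃ s ∈ S, openEdgeCluster ω s)} ∩
            {ω | ∀ s ∈ S, ∀ t ∈ T, ¬ (openGraph ω).Reachable s t}) := by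
  -- parameters: `r⁺ = max r 0`, `b = (1 + 4r⁺)/6`, `a = (2 + 2r⁺)/3`
  set r' : ℝ := max r 0 with hr'
  have hr'0 : 0 ≤ r' := le_max_right _ _
  have hr'1 : r' < 1 / 2 := max_lt hr (by norm_num)
  have hrr' : r ≤ r' := le_max_left _ _
  have ha0 : (0 : ℝ) ≤ (2 + 2 * r') / 3 := by positivity
  have ha1 : (2 + 2 * r') / 3 ≤ (1 : ℝ) := by linarith
  have hb0 : (0 : ℝ) ≤ (1 + 4 * r') / 6 := by positivity
  have hb1 : (1 + 4 * r') / 6 ≤ (1 : ℝ) := by linarith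
  set a : unitInterval := ⟨(2 + 2 * r') / 3, ha0, ha1⟩ with ha
  set b : unitInterval := ⟨(1 + 4 * r') / 6, hb0, hb1⟩ with hb
  -- the weights: `01 ↦ a`, `12 ↦ 1`, `02 ↦ a`, `23 ↦ b`, every other pair `0`
  set W : Sym2 (Fin 4) → unitInterval := fun e =>
    if e = s(0, 1) then a else if e = s(1, 2) then 1 else if e = s(0, 2) then a else if e = s(2, 3) then b else 0 with hW
  have w01 : W s(0, 1) = a := by simp [hW]
  have w12 : W s(1, 2) = 1 := by simp [hW]
  have w02 : W s(0, 2) = a := by simp [hW]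
  have w23 : W s(2, 3) = b := by simp [hW]
  have hw0 : ∀ e, e ∉ ({s((0 : Fin 4), 1), s(1, 2), s(0, 2), s(2, 3)} : Finset (Sym2 (Fin 4))) → W e = 0 := by
    intro e he
    simp only [Finset.mem_insert, Finset.mem_singleton, not_or] at he
    simp [hW, he.1, he.2.1, he.2.2.1, he.2.2.2]
  have h01 : (0 : Fin 4) ≠ 1 := by decide
  have h02 : (0 : Fin 4) ≠ 2 := by decide
  have h03 : (0 : Fin 4) ≠ 3 := by decide
  have h12 : (1 : Fin 4) ≠ 2 := by decide
  have h13 : (1 : Fin 4) ≠ 3 := by decide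
  have h23 : (2 : Fin 4) ≠ 3 := by decide
  have ca : ((W s(0, 1) : unitInterval) : ℝ) = (2 + 2 * r') / 3 := by rw [w01]
  have cc : ((W s(0, 2) : unitInterval) : ℝ) = (2 + 2 * r') / 3 := by rw [w02]
  have cb : ((W s(2, 3) : unitInterval) : ℝ) = (1 + 4 * r') / 6 := by rw [w23]
  have c1 : ((W s(1, 2) : unitInterval) : ℝ) = 1 := by rw [w12, Set.Icc.coe_one]
  refine ⟨4, W, {0}, {3}, fun C => s(0, 1) ∈ C, fun C => s(0, 2) ∈ C,
    fun C C' hCC' h => hCC' h, fun C C' hCC' h => hCC' h, ?_, ?_⟩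
  · -- `μ(S ↔ T) = b·(2a − a²) > r⁺ ≥ r`
    rw [CrossReachSharp.reachEvent_eq, (CrossReachSharp.cells _ h01 h02 h03 h12 h13 h23 hw0).1, ca, cb, cc, c1]
    have hδ : 0 < (1 - 2 * r') / 3 := by linarith
    have hδ' : 0 < 1 - (1 - 2 * r') / 3 := by linarith
    have key : (1 + 4 * r') / 6 * ((2 + 2 * r') / 3 + (2 + 2 * r') / 3 * 1 - (2 + 2 * r') / 3 * ((2 + 2 * r') / 3 * 1)) - r' =
        (1 - 2 * r') / 3 * (1 - (1 - 2 * r') / 3) / 2 + ((1 - 2 * r') / 3) ^ 3 := by ring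
    have hpos : 0 < (1 - 2 * r') / 3 * (1 - (1 - 2 * r') / 3) / 2 + ((1 - 2 * r') / 3) ^ 3 := by positivity
    linarith
  · exact crossReach_theta_lt (W) h01 h02 h03 h12 h13 h23 hw0 (by rw [ca]; linarith)
      (by rw [ca]; linarith) (by rw [c1]; norm_num) (by rw [cc]; linarith) (by rw [cc]; linarith) (by rw [cb]; linarith)
      (by rw [cb]; linarith)

end Consts

end Summit.CriticalPhenomena.PercolationContinuityZ3.Theorems
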